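import Literature.Probability.LatticeModels.PlaneRotatorStiffnessHighTemperatureLieb
import HarnessLib

/-!
# Lieb's Theorem 4 for nearest-neighbour plane rotators in `PlaneRotator.twoPoint` vocabulary:
# `⟨cos(θ_a − θ_c)⟩_{Λ,K} ≤ (2d·u(K))^{‖a − c‖₁}` on every finite `Λ ⊂ ℤ^d`, and `(4u(K))^{dist₁(a,c)}` on `(ℤ/Lℤ)²`

Topic `Literature/Probability/LatticeModels`. A vocabulary file (everything PROVED, no definition, no named fact):
Lieb's decay criterion with the two-spin values `u(K) = I₁(K)/I₀(K)` (`PlaneRotator.besselRatio`), which the tree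
holds as the general statement `PlaneRotator.twoPoint_le_pow_of_besselRatio_rowSum_le` (`PlaneRotatorLiebCriterion.lean`,
Lieb 1980 Thm 4 with eq. (23) / Rivasseau 1980) and, for the layered model on `ℤ³`, as
`twoPoint_layered_le_pow_besselRatio`, is written out here

* §1 for the **isotropic nearest-neighbour model on a finite `Λ ⊂ ℤ^d`** (free boundary conditions, the coupling
  function `nnXYCoupling K d Λ` of the box / slab / strand files): `twoPoint (nnXYCoupling K d Λ) a c ≤
  (2d·u(K))^{‖a − c‖₁}` (`PlaneRotator.twoPoint_nn_le_pow_besselRatio`) — Lieb's improvement of the mean-field rate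
  `(dK)^{‖a − c‖₁}` of `twoPoint_nn_le_pow` (`u(K) ≤ K/2`, `twoPoint_nn_le_pow_besselRatio_le_meanField`); decay
  uniformly in the volume as soon as `2d·u(K) < 1` (`d = 2`: `K < u⁻¹(¼) ≈ 0.516`, `β_c ≥ 0.52` in Lieb's table;
  `d = 3`: `K < u⁻¹(⅙) ≈ 0.34`);
* §2 for the **periodic model `torusXY 2 L`** in the SAME vocabulary, through the tree's bridge
  `BondSystem.expectJ_cosDiff_eq_twoPoint` (fibre-summed pair coupling `BondSystem.pairCoupling`):
  `twoPoint ((torusXY 2 L).pairCoupling K) a c ≤ (4u(K))^{dist₁(a,c)}` for `L ≥ 3`, `K ≥ 0`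
  (`torusXY_twoPoint_le_pow_torusDistOne`, re-exporting `torusXY_expectJ_cosDiff_le_pow_torusDistOne` of
  `PlaneRotatorStiffnessHighTemperatureLieb.lean` §7), with the Ginibre floor `0 ≤ ·`.

Reading (cell `pub/hubbard-tc`, MO-S3): one sentence — Lieb's high-temperature phase `2d·u(K) < 1` — now reads the
same way for the free boxes of the K5 box/slab criteria and for the torus of the `Υ_L` files.

## What this is not

A classical comparison-model statement at high temperature; nothing about electrons or `T_c`; no number of the
cell's tables moves; no new inequality beyond Lieb's (the box criteria `twoPoint_nn_le_pow_boxShellSum`, `R ≥ 2`,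
remain the sharper finite algorithm).

## References

* E. H. Lieb, Comm. Math. Phys. 77 (1980) 127–135, Theorem 4 and eq. (25). [Lieb1980]
* V. Rivasseau, Comm. Math. Phys. 77 (1980) 145–147. [Rivasseau1980]
* M. Aizenman, B. Simon, Comm. Math. Phys. 77 (1980) 137, Thm 3.2 (the mean-field rate). [AizenmanSimon1980LocalWard]
-/

noncomputable section

open MeasureTheory Finset
open scoped BigOperators

namespace Literature.Probability.LatticeModels

open PlaneRotator Literature.Barriers.CriticalPhenomena Literature.Barriers.CriticalPhenomena.LongRangeIsing
open Literature.MathematicalPhysics.QuantumLattice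

variable [MeasurableSpace Circle] [BorelSpace Circle]

/-! ## §1 Free boundary conditions: `Λ ⊂ ℤ^d` -/

section Free

omit [MeasurableSpace Circle] [BorelSpace Circle] in
/-- The symmetrised nearest-neighbour coupling is `K` on nearest-neighbour pairs and `0` elsewhere.
[cite: Lieb1980, Theorem 4 (nearest-neighbour rotators on a hypercubic lattice)] -/
theorem PlaneRotator.nnXYCoupling_add_swap (K : ℝ) {d : ℕ} (Λ : Finset (Site d)) (x y : Λ) :
    nnXYCoupling K d Λ (x, y) + nnXYCoupling K d Λ (y, x) = K * nnCoupling d (x : Site d) (y : Site d) := by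
  unfold nnXYCoupling nnCoupling
  rw [l1Norm_sub_comm (y : Site d) (x : Site d)]
  ring

omit [MeasurableSpace Circle] [BorelSpace Circle] in
/-- The two-spin value of a nearest-neighbour pair: `u(K·ν(x,y)) = ν(x,y)·u(K)` (`ν ∈ {0, 1}`, `u(0) = 0`).
[cite: Lieb1980, eq. (25) (two-spin system)] -/
theorem PlaneRotator.besselRatio_mul_nnCoupling (K : ℝ) {d : ℕ} (x y : Site d) :
    besselRatio (K * nnCoupling d x y) = nnCoupling d x y * besselRatio K := by
  unfold nnCoupling
  split_ifs
  · rw [mul_one, one_mul]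
  · rw [mul_zero, zero_mul, besselRatio_zero]

omit [MeasurableSpace Circle] [BorelSpace Circle] in
/-- **The Bessel-ratio row sums of the nearest-neighbour model**: `∑_{y ≠ x} u(J(x,y) + J(y,x)) ≤ 2d·u(K)` on every
finite `Λ ⊂ ℤ^d` (at most `2d` neighbours inside `Λ`). [cite: Lieb1980, Theorem 4 (the criterion 2ν·I₁(β)/I₀(β) < 1)] -/
theorem PlaneRotator.nn_besselRatio_rowSum_le {K : ℝ} (hK : 0 ≤ K) {d : ℕ} (Λ : Finset (Site d)) (x : Λ) :
    ∑ y ∈ Finset.univ.erase x,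
      besselI 1 (nnXYCoupling K d Λ (x, y) + nnXYCoupling K d Λ (y, x)) /
        besselI 0 (nnXYCoupling K d Λ (x, y) + nnXYCoupling K d Λ (y, x)) ≤ 2 * d * besselRatio K := by
  have hu := besselRatio_nonneg hK
  have hterm : ∀ y : Λ, besselI 1 (nnXYCoupling K d Λ (x, y) + nnXYCoupling K d Λ (y, x)) /
      besselI 0 (nnXYCoupling K d Λ (x, y) + nnXYCoupling K d Λ (y, x)) =
        nnCoupling d (x : Site d) (y : Site d) * besselRatio K := fun y => by
    rw [nnXYCoupling_add_swap, ← besselRatio, besselRatio_mul_nnCoupling]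
  -- the coordination bound `∑_y ν(x,y) ≤ 2d`, read off the tree's `sum_nnXYCoupling_le` at `K = 1`
  have hcoord : ∑ y : Λ, nnCoupling d (x : Site d) (y : Site d) ≤ 2 * d := by
    have h := sum_nnXYCoupling_le (K := 1) zero_le_one Λ x
    simp_rw [nnXYCoupling_add_swap, one_mul] at h
    simpa using h
  calc ∑ y ∈ Finset.univ.erase x, besselI 1 (nnXYCoupling K d Λ (x, y) + nnXYCoupling K d Λ (y, x)) /
          besselI 0 (nnXYCoupling K d Λ (x, y) + nnXYCoupling K d Λ (y, x))
      = ∑ y ∈ Finset.univ.erase x, nnCoupling d (x : Site d) (y : Site d) * besselRatio K :=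
        Finset.sum_congr rfl fun y _ => hterm y
    _ ≤ ∑ y : Λ, nnCoupling d (x : Site d) (y : Site d) * besselRatio K :=
        Finset.sum_le_sum_of_subset_of_nonneg (Finset.erase_subset _ _) fun y _ _ =>
          mul_nonneg (nnCoupling_nonneg _ _) hu
    _ = (∑ y : Λ, nnCoupling d (x : Site d) (y : Site d)) * besselRatio K := (Finset.sum_mul _ _ _).symm
    _ ≤ 2 * d * besselRatio K := mul_le_mul_of_nonneg_right hcoord hu

/-- **Lieb's Theorem 4 for the nearest-neighbour plane rotator on a finite `Λ ⊂ ℤ^d`** (free boundary conditions),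
in the `twoPoint` vocabulary of the box / slab files: for `K ≥ 0` and `a, c ∈ Λ`,
`⟨cos(θ_a − θ_c)⟩_{Λ,K} ≤ (2d·u(K))^{‖a − c‖₁}`, `u = I₁/I₀` — the same rate in every volume, exponential decay as soon
as `2d·u(K) < 1` (`d = 2`: `K < u⁻¹(¼)`, Lieb's `β_c ≥ 0.52`; `d = 3`: `β_c ≥ 0.34`).
[cite: Lieb1980, Theorem 4 (β_c ≥ 0.52 for ν = 2, ≥ 0.34 for ν = 3)] -/
theorem PlaneRotator.twoPoint_nn_le_pow_besselRatio {K : ℝ} (hK : 0 ≤ K) {d : ℕ} (Λ : Finset (Site d)) (a c : Λ) :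
    twoPoint (nnXYCoupling K d Λ) a c ≤ (2 * d * besselRatio K) ^ l1Norm ((a : Site d) - (c : Site d)) := by
  classical
  have hJ : ∀ p : Λ × Λ, 0 ≤ nnXYCoupling K d Λ p := fun p =>
    mul_nonneg (div_nonneg hK zero_le_two) (nnCoupling_nonneg _ _)
  refine twoPoint_le_pow_of_besselRatio_rowSum_le hJ (nn_besselRatio_rowSum_le hK Λ) c
    (d := fun y : Λ => l1Norm ((y : Site d) - (c : Site d))) (by simp [l1Norm]) ?_ a
  -- the `ℓ¹` distance to `c` is `1`-Lipschitz along nearest-neighbour bonds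
  intro x y _ hxy
  have hne : nnCoupling d (x : Site d) (y : Site d) ≠ 0 := by
    intro h0
    have hxy0 : nnXYCoupling K d Λ (x, y) = 0 := by unfold nnXYCoupling; rw [h0, mul_zero]
    have hyx0 : nnXYCoupling K d Λ (y, x) = 0 := by
      have h := nnXYCoupling_add_swap K Λ x y
      rw [h0, mul_zero, hxy0, zero_add] at h
      exact h
    rcases hxy with h | h
    · exact h hxy0
    · exact h hyx0
  have h1 : l1Norm ((x : Site d) - (y : Site d)) = 1 := by
    unfold nnCoupling at hne
    by_contra h
    exact hne (if_neg h)
  have htri : l1Norm ((x : Site d) - (y : Site d) + ((y : Site d) - (c : Site d))) ≤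
      l1Norm ((x : Site d) - (y : Site d)) + l1Norm ((y : Site d) - (c : Site d)) := by
    unfold l1Norm
    rw [← Finset.sum_add_distrib]
    exact Finset.sum_le_sum fun i _ => Int.natAbs_add_le _ _
  rw [sub_add_sub_cancel, h1] at htri
  show l1Norm ((x : Site d) - (c : Site d)) ≤ l1Norm ((y : Site d) - (c : Site d)) + 1
  omega

/-- With the Ginibre floor: `0 ≤ ⟨cos(θ_a − θ_c)⟩_{Λ,K} ≤ (2d·u(K))^{‖a − c‖₁}`. [cite: Lieb1980, Theorem 4] -/
theorem PlaneRotator.twoPoint_nn_mem_Icc_pow_besselRatio {K : ℝ} (hK : 0 ≤ K) {d : ℕ} (Λ : Finset (Site d))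
    (a c : Λ) :
    twoPoint (nnXYCoupling K d Λ) a c ∈
      Set.Icc 0 ((2 * d * besselRatio K) ^ l1Norm ((a : Site d) - (c : Site d))) :=
  ⟨twoPoint_nonneg (fun _ => mul_nonneg (div_nonneg hK zero_le_two) (nnCoupling_nonneg _ _)) a c,
    twoPoint_nn_le_pow_besselRatio hK Λ a c⟩

omit [MeasurableSpace Circle] [BorelSpace Circle] in
/-- **Lieb's rate is at least as good as the mean-field rate**: `2d·u(K) ≤ d·K` (`u(K) ≤ K/2`, tree
`besselRatio_le_half`), so `twoPoint_nn_le_pow_besselRatio` implies `twoPoint_nn_le_pow`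
(Aizenman–Simon's `(dK)^{‖a − c‖₁}`). [cite: Lieb1980, Theorem 4 and the remark after eq. (25) (comparison with Simon's bound)] -/
theorem PlaneRotator.twoPoint_nn_le_pow_besselRatio_le_meanField {K : ℝ} (hK : 0 ≤ K) (d : ℕ) (n : ℕ) :
    (2 * d * besselRatio K) ^ n ≤ (d * K) ^ n := by
  have hu := besselRatio_nonneg hK
  refine pow_le_pow_left₀ (by positivity) ?_ n
  have h := besselRatio_le_half hK
  rw [← besselRatio] at h
  calc 2 * (d : ℝ) * besselRatio K ≤ 2 * d * (K / 2) := mul_le_mul_of_nonneg_left h (by positivity)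
    _ = d * K := by ring

/-- `d = 2`: `⟨cos(θ_a − θ_c)⟩_{Λ,K} ≤ (4u(K))^{‖a − c‖₁}` on every finite `Λ ⊂ ℤ²` — the rate of the torus file
(`torusXY_expectJ_cosDiff_le_pow_torusDistOne`) and of the `R = 1` box (`boxShellSum_one`: the star).
[cite: Lieb1980, Theorem 4 (ν = 2: β_c ≥ 0.52)] -/
theorem PlaneRotator.twoPoint_nn_two_le_pow_besselRatio {K : ℝ} (hK : 0 ≤ K) (Λ : Finset (Site 2)) (a c : Λ) :
    twoPoint (nnXYCoupling K 2 Λ) a c ≤ (4 * besselRatio K) ^ l1Norm ((a : Site 2) - (c : Site 2)) := by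
  have h := twoPoint_nn_le_pow_besselRatio hK Λ a c
  norm_num at h
  exact h

end Free

/-! ## §2 Periodic boundary conditions: `(ℤ/Lℤ)²` in the same vocabulary -/

section Torus

variable {L : ℕ} [NeZero L]

/-- **Lieb's bound on the torus in `twoPoint` vocabulary**: for `L ≥ 3`, `K ≥ 0` and all sites `a, c` of `(ℤ/Lℤ)²`,
`PlaneRotator.twoPoint ((torusXY 2 L).pairCoupling K) a c ≤ (4u(K))^{dist₁(a,c)}` — the torus two-point function
`⟨cos(θ_a − θ_c)⟩_{K,L}` written as the Ginibre pair-coupling expectation of the box files (bridge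
`BondSystem.expectJ_cosDiff_eq_twoPoint`). [cite: Lieb1980, Theorem 4 (ν = 2: exponential fall-off iff I₁(β)/I₀(β) < 1/4)] -/
theorem torusXY_twoPoint_le_pow_torusDistOne (hL : 3 ≤ L) {K : ℝ} (hK : 0 ≤ K) (a c : TorusSite 2 L) :
    PlaneRotator.twoPoint ((torusXY 2 L).pairCoupling fun _ => K) a c ≤ (4 * besselRatio K) ^ torusDistOne a c := by
  rw [← (torusXY 2 L).expectJ_cosDiff_eq_twoPoint]
  exact torusXY_expectJ_cosDiff_le_pow_torusDistOne hL hK a c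

/-- With the Ginibre floor: `0 ≤ PlaneRotator.twoPoint ((torusXY 2 L).pairCoupling K) a c ≤ (4u(K))^{dist₁(a,c)}`.
[cite: Lieb1980, Theorem 4 (ν = 2)] -/
theorem torusXY_twoPoint_mem_Icc_pow_torusDistOne (hL : 3 ≤ L) {K : ℝ} (hK : 0 ≤ K) (a c : TorusSite 2 L) :
    PlaneRotator.twoPoint ((torusXY 2 L).pairCoupling fun _ => K) a c ∈ Set.Icc 0 ((4 * besselRatio K) ^ torusDistOne a c) :=
  ⟨twoPoint_nonneg ((torusXY 2 L).pairCoupling_nonneg fun _ => hK) a c,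
    torusXY_twoPoint_le_pow_torusDistOne hL hK a c⟩

/-- The three vocabularies agree: `twoPoint (pairCoupling K) a c = ⟨cos(θ_a − θ_c)⟩_J = (torusXY 2 L).expect K 1 (cosDiff a c)`.
[cite: Ginibre1970, Example 4 (plane rotators, general couplings J_A)] -/
theorem torusXY_twoPoint_eq_expect (K : ℝ) (a c : TorusSite 2 L) :
    PlaneRotator.twoPoint ((torusXY 2 L).pairCoupling fun _ => K) a c = (torusXY 2 L).expect K 1 (cosDiff a c) := by
  rw [← (torusXY 2 L).expectJ_cosDiff_eq_twoPoint, (torusXY 2 L).expect_one_eq_expectJ]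

end Torus

end Literature.Probability.LatticeModels
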